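import Summits.MatrixMultiplication.OmegaCensus.DominoZpZpStructFiveCore
import Summits.MatrixMultiplication.OmegaCensus.DominoZ5LineTables
import HarnessLib

/-!
# Compressed certified line tables for the structural part-`5` route (character-pair certificates)

ω-census `pub-omega`, family (b3), seat pub-omega-group gen 23.  Framing: lottery ticket; floor = certified bounds/negative
ranges.  VALUE: a denser FILE FORMAT for the per-prime certified tables of `DominoZpZpStructFive.lean` (needed for `p = 29, 31`,
whose tables have ≈ 5 000 keys): NOT progress on ω, and no new mathematics — the expanded table is checked by the SAME kernel
predicate `lineCert` of `DominoZ5LineTables.lean`.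

A modular Farkas certificate `(N, z)` of a key `F` on `ZMod q` (see `DominoLineCertificate.lean`) at a SPLIT prime `N ≡ 1 (mod q)`
dividing the cyclotomic norm of `D = α² + αᾱ + ᾱ²` can be taken of the form `z(τ) = (c₁·ρ^τ + c₂·ρ^{q−τ}) mod N` with `ρ` a `q`-th
root of unity mod `N` at which `D(α(ρ)) ≡ 0` and `(c₁, c₂) = (ᾱ, −(α+ᾱ))` or `(α+ᾱ, −α)`: then `Σ_τ z(τ)·L_F(τ,v) ≡ 0` for all `v`,
`Σ z ≡ 0`, and `z(s) ≢ 0` for all but at most one `s`.  Such a certificate is stored as FOUR numbers `(N, ρ, c₁, c₂)` instead of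
`q + 1`; `expandCC` recomputes `z` in the kernel (`Nat.pow`, `Nat.mod`).  A compressed entry is `((n₀,…,n₄), (charCerts, explicitCerts))`
with the normalised tuple in place of its count vector (`cv5`); `expandTable5` produces the table in the format of the other files,
so `tabTree`, `tabWF`, `checkFive` and the cells theorems apply unchanged, and the `…_cert` theorems are the usual
`∀ e ∈ expandTable5 q T, lineCert q (vecFn e.1) e.2 = true` decided in the kernel.  Generator: `pub-omega-group-g23/code/gen_struct5c.py`.
-/

namespace Summit.MatrixMultiplication.OmegaCensus

namespace ZpZpDomino

/-- Expansion of a character-pair certificate `(N, ρ, c₁, c₂)` to `(N, z)` with `z(τ) = (c₁ρ^τ + c₂ρ^{q−τ}) mod N`. [folklore] -/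
def expandCC (q : ℕ) (c : ℕ × ℕ × ℕ × ℕ) : ℕ × List ℕ :=
  (c.1, (List.range q).map fun τ => (c.2.2.1 * c.2.1 ^ τ + c.2.2.2 * c.2.1 ^ (q - τ)) % c.1)

/-- Expansion of a compressed table entry: count vector of the normalised tuple, character certificates expanded, explicit
certificates appended. [folklore] -/
def expandEntry5 (q : ℕ) (e : (ℕ × ℕ × ℕ × ℕ × ℕ) × (List (ℕ × ℕ × ℕ × ℕ) × List (ℕ × List ℕ))) :
    List ℕ × List (ℕ × List ℕ) :=
  (cv5 q e.1.1 e.1.2.1 e.1.2.2.1 e.1.2.2.2.1 e.1.2.2.2.2, e.2.1.map (expandCC q) ++ e.2.2)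

/-- Expansion of a compressed table. [folklore] -/
def expandTable5 (q : ℕ) (T : List ((ℕ × ℕ × ℕ × ℕ × ℕ) × (List (ℕ × ℕ × ℕ × ℕ) × List (ℕ × List ℕ)))) :
    List (List ℕ × List (ℕ × List ℕ)) :=
  T.map (expandEntry5 q)

/-- Expansion of a residue-degree-2 certificate `(N, d, ρ₁, ρ₂, A, B)`: `ρ = ρ₁ + ρ₂ t` is a `q`-th root of unity in
`𝔽_N[t]/(t² − d)` (`d` a non-residue, `N ≡ −1 (mod q)`), and `z(τ) = (A·re(ρ^τ) + B·im(ρ^τ)) mod N` — a trace form of the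
character-pair certificate over `𝔽_{N²}`; SIX numbers instead of `q + 1`. (No correctness claim is needed: the expanded `(N, z)` is
re-checked by `lineCert`.) [folklore] -/
def expandCC2 (q : ℕ) (c : ℕ × ℕ × ℕ × ℕ × ℕ × ℕ) : ℕ × List ℕ :=
  let N := c.1
  let d := c.2.1
  let ra := c.2.2.1
  let rb := c.2.2.2.1
  let A := c.2.2.2.2.1
  let B := c.2.2.2.2.2
  (N, ((List.range q).foldl
      (fun (acc : List ℕ × ℕ × ℕ) _ =>
        (acc.1 ++ [(A * acc.2.1 + B * acc.2.2) % N], (acc.2.1 * ra + acc.2.2 * rb * d) % N, (acc.2.1 * rb + acc.2.2 * ra) % N))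
      ([], 1, 0)).1)

/-- Expansion of a compressed table entry with all three certificate kinds: `((n₀,…,n₄), (charCerts, char2Certs, explicitCerts))`.
[folklore] -/
def expandEntry5b (q : ℕ)
    (e : (ℕ × ℕ × ℕ × ℕ × ℕ) × (List (ℕ × ℕ × ℕ × ℕ) × List (ℕ × ℕ × ℕ × ℕ × ℕ × ℕ) × List (ℕ × List ℕ))) :
    List ℕ × List (ℕ × List ℕ) :=
  (cv5 q e.1.1 e.1.2.1 e.1.2.2.1 e.1.2.2.2.1 e.1.2.2.2.2,
    e.2.1.map (expandCC q) ++ (e.2.2.1.map (expandCC2 q) ++ e.2.2.2))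

/-- Expansion of a compressed table (three certificate kinds). [folklore] -/
def expandTable5b (q : ℕ)
    (T : List ((ℕ × ℕ × ℕ × ℕ × ℕ) × (List (ℕ × ℕ × ℕ × ℕ) × List (ℕ × ℕ × ℕ × ℕ × ℕ × ℕ) × List (ℕ × List ℕ)))) :
    List (List ℕ × List (ℕ × List ℕ)) :=
  T.map (expandEntry5b q)

end ZpZpDomino

end Summit.MatrixMultiplication.OmegaCensus
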